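import Literature.AlgebraicGeometry.AbelianSchemes.AbelianSchemeOverRigidityNoetherian
import Literature.AlgebraicGeometry.AbelianSchemes.AbelianSchemeOverLevelBaseChange
import Literature.AlgebraicGeometry.Deformation.LocalHilbertFunctor
import HarnessLib

/-!
# A first-order deformation of the identity of an abelian scheme is a translation: `Φ(a, ε) = a + Φ(e, ε)`
# (Mumford–Fogarty–Kirwan, *GIT* Cor. 6.2 over the Artin base `Spec k[ε]`; Mumford, *Abelian Varieties* §13 p. 125)

Layer `Literature/AlgebraicGeometry/AbelianSchemes`, namespace `Literature.AlgebraicGeometry.AbelianSchemes.AbelianSchemeOver`.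
THEOREMS ONLY (no definition, no instance, no notation, no named fact, no `sorry`).

Let `A` be an abelian scheme over a field `k`, `R ∈ Art_k` (the tree's `Deformation.ArtAlg`; the case of record is
`R = k[ε]`, `ArtAlg.sqZeroExt k`), `T = Spec R → Spec k` (`R.specOver`) and `Φ : A ⊗ T ⟶ A` a morphism OVER `Spec k`
which restricts to the identity on the closed fibre (`closedFibreι A.X R ≫ Φ.left = 𝟙`).  Then `Φ` IS THE TRANSLATION
by its value at the origin `u := (e, 𝟙_T) ≫ Φ : T ⟶ A`:  `(A ◁ u) ≫ μ = Φ` — «`Φ(a, ε) = a + u(ε)`» — the letter (β)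
of the cell's `SOCKETS-I2a-seam.v0` (F-11 (I2-a), «`φ_L` injective»): the first-order FLOW of a global vector field
(★ `Deformation/VectorFieldFirstOrderFlow`) is the translation by a `k[ε]`-point, [MumfordAV1970] §13 p. 125.

Proof ([MumfordFogartyKirwan1994] Ch. 6 §1 Cor. 6.2 over the connected Artin base `Spec R`, no reducedness — ★
`AbelianSchemeOverRigidityNoetherian.eq_section_mul_of_pullback_fst_comp_eq_of_isLocallyNoetherian`): read `Φ` and the
translation `τ = (A ◁ u) ≫ μ` as `T`-endomorphisms `Φ', τ'` of the abelian scheme `A_T = A.baseChange T.hom`; both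
restrict to the identity on the closed fibre (`Φ` by hypothesis; `τ` because `u(closed point) = e` and `A ◁ η ≫ μ = ρ`),
so they agree on the geometric fibre over the closed point of `Spec R` and Cor. 6.2 gives `Φ' = σ · τ'` for the
constant section `σ = p_T^*((Φ' · τ'⁻¹)(e))`; but `Φ'(e) = τ'(e) = u`, so `σ = 1` and `Φ' = τ'`.  All group-law
bookkeeping happens in `Hom_T(–, A_T)`; no comparison of the group laws of `Over (Spec R)` and `Over (Spec k)` is needed.

* §1 plumbing in a cartesian-monoidal `Over S`: `((ρ_ X)⁻¹ ≫ X ◁ s).left` as a `pullback.lift`; the closed fibre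
  `closedFibreι X R` IS `(ρ⁻¹ ≫ X ◁ s₀).left` for the closed point `s₀ : 𝟙 ⟶ Spec R`;
* §2 **`whiskerLeft_comp_mul_eq_of_closedFibreι_comp_eq_id`** — the head.

Cell hodgecm-mathlib (D-0151), F0P1b WAVE 4 (W4-2) (I2-a) road step (β) (B-p08 (g16)); count-neutral generic capital.
HC_CM is proved only modulo the 7 printed citations until rung 0 closes; this file asserts nothing about HC.

## References
* [MumfordFogartyKirwan1994] D. Mumford, J. Fogarty, F. Kirwan, *Geometric Invariant Theory*, 3rd ed. (1994), Ch. 6 §1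
  Cor. 6.2 (p. 116), Cor. 6.4 (p. 117).
* [MumfordAV1970] D. Mumford, *Abelian Varieties* (1970), §13, proof of the Theorem (p. 125); §4 (rigidity, p. 43).
* [GortzWedhorn2020] U. Görtz, T. Wedhorn, *Algebraic Geometry I*, 2nd ed. (2020), Section (4.7) (pp. 107–108).
-/

noncomputable section

-- `(X ⊗ T).left = pullback X.hom T.hom` and `(𝟙_ (Over S)).left = S` hold by `rfl` but not at instance transparency
-- (as in ★ `AbelianSchemes/AbelianSchemeKOfL`).
set_option backward.isDefEq.respectTransparency false

universe u

open CategoryTheory CategoryTheory.Limits AlgebraicGeometry MonoidalCategory CartesianMonoidalCategory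
open scoped MonObj

namespace Literature.AlgebraicGeometry.AbelianSchemes

open Literature.AlgebraicGeometry.Deformation Literature.AlgebraicGeometry.Motives

/-! ## §1 Plumbing: `(ρ⁻¹ ≫ X ◁ s).left` and the closed fibre -/

section Plumbing

variable {S : Scheme.{u}} (X : Over S) {T : Over S} (s : 𝟙_ (Over S) ⟶ T)

/-- `(ρ_X⁻¹ ≫ X ◁ s) ≫ p_X = 𝟙_X`. [cite: GortzWedhorn2020, Section (4.7) (pp. 107–108)] -/
theorem rightUnitor_inv_whiskerLeft_fst : ((ρ_ X).inv ≫ X ◁ s) ≫ fst X T = 𝟙 X := by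
  rw [Category.assoc, whiskerLeft_fst, ← rightUnitor_hom, Iso.inv_hom_id]

/-- `(ρ_X⁻¹ ≫ X ◁ s) ≫ p_T = p ≫ s`. [cite: GortzWedhorn2020, Section (4.7) (pp. 107–108)] -/
theorem rightUnitor_inv_whiskerLeft_snd : ((ρ_ X).inv ≫ X ◁ s) ≫ snd X T = toUnit X ≫ s := by
  rw [Category.assoc, whiskerLeft_snd, ← Category.assoc]
  congr 1
  exact toUnit_unique _ _

/-- On underlying schemes, the first component of `ρ_X⁻¹ ≫ X ◁ s : X ⟶ X ×_S T` is `𝟙`.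
[cite: GortzWedhorn2020, Section (4.7) (pp. 107–108)] -/
theorem rightUnitor_inv_whiskerLeft_left_fst :
    ((ρ_ X).inv ≫ X ◁ s).left ≫ pullback.fst X.hom T.hom = 𝟙 X.left := by
  have h : (((ρ_ X).inv ≫ X ◁ s) ≫ fst X T).left = (𝟙 X : X ⟶ X).left := by rw [rightUnitor_inv_whiskerLeft_fst]
  rw [Over.comp_left, Over.id_left] at h
  exact h

/-- On underlying schemes, the second component of `ρ_X⁻¹ ≫ X ◁ s : X ⟶ X ×_S T` is `p_X ≫ s`.
[cite: GortzWedhorn2020, Section (4.7) (pp. 107–108)] -/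
theorem rightUnitor_inv_whiskerLeft_left_snd :
    ((ρ_ X).inv ≫ X ◁ s).left ≫ pullback.snd X.hom T.hom = (toUnit X ≫ s).left := by
  have h : (((ρ_ X).inv ≫ X ◁ s) ≫ snd X T).left = (toUnit X ≫ s).left := by rw [rightUnitor_inv_whiskerLeft_snd]
  rw [Over.comp_left] at h
  exact h

/-- `η ≫ ρ_X⁻¹ ≫ X ◁ s = (η, s)` for any `η : 𝟙 ⟶ X`. [cite: GortzWedhorn2020, Section (4.7) (pp. 107–108)] -/
theorem comp_rightUnitor_inv_whiskerLeft (e : 𝟙_ (Over S) ⟶ X) : e ≫ (ρ_ X).inv ≫ X ◁ s = lift e s := by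
  apply CartesianMonoidalCategory.hom_ext
  · rw [lift_fst, Category.assoc, rightUnitor_inv_whiskerLeft_fst, Category.comp_id]
  · rw [lift_snd, Category.assoc, rightUnitor_inv_whiskerLeft_snd, ← Category.assoc,
      show e ≫ toUnit X = 𝟙 _ from toUnit_unique _ _, Category.id_comp]

end Plumbing

section ClosedPoint

variable {k : Type u} [Field k] (X : Motives.SchemeOver k) (R : ArtAlg.{u} k)

/-- **The closed fibre is `(𝟙_X, p_X ≫ s₀)`**: for any `s₀ : 𝟙 ⟶ Spec R` over `Spec k` whose underlying map is the closed
point, `closedFibreι X R = (ρ_X⁻¹ ≫ X ◁ s₀).left`. [cite: GortzWedhorn2020, Section (4.7) (pp. 107–108)] -/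
theorem closedFibreι_eq_left (s₀ : 𝟙_ (Motives.SchemeOver k) ⟶ R.specOver)
    (hs₀ : s₀.left = Spec.map (CommRingCat.ofHom R.residue.toRingHom)) :
    closedFibreι X R = ((ρ_ X).inv ≫ X ◁ s₀).left := by
  apply pullback.hom_ext
  · rw [closedFibreι_fst, rightUnitor_inv_whiskerLeft_left_fst]
  · rw [closedFibreι_snd, rightUnitor_inv_whiskerLeft_left_snd, Over.comp_left, Over.toUnit_left, hs₀]

end ClosedPoint

/-! ## §2 A deformation of the identity over `Spec R`, `R ∈ Art_k`, is the translation by its value at the origin -/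

namespace AbelianSchemeOver

variable {k : Type u} [Field k] (A : AbelianSchemeOver (Spec (.of k))) (R : ArtAlg.{u} k)

/-- `Spec R` has one point for `R` Artin local. [cite: MumfordFogartyKirwan1994, Ch. 6 §1 Cor. 6.2 (p. 116)] -/
theorem subsingleton_specOver_left : Subsingleton ↥(R.specOver.left) :=
  ⟨fun p q => PrimeSpectrum.ext ((IsLocalRing.eq_maximalIdeal (inferInstance : p.asIdeal.IsMaximal)).trans
    (IsLocalRing.eq_maximalIdeal (inferInstance : q.asIdeal.IsMaximal)).symm)⟩

/-- **A FIRST-ORDER (more generally: ARTIN-LOCAL) DEFORMATION OF THE IDENTITY OF AN ABELIAN SCHEME IS A TRANSLATION**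
(letter (β) of the cell's `SOCKETS-I2a-seam.v0`).  `A` an abelian scheme over a field `k`, `R ∈ Art_k`, `Φ : A ⊗ Spec R ⟶ A`
over `Spec k` with `closedFibreι ≫ Φ = 𝟙` (the identity on the closed fibre).  Then with `u := (e, 𝟙) ≫ Φ : Spec R ⟶ A`
(the value of `Φ` at the origin): `(A ◁ u) ≫ μ = Φ`, i.e. `Φ(a, t) = a + u(t)`.  Proof: [MumfordFogartyKirwan1994] Cor. 6.2
over the connected Artin base `Spec R` (★ `eq_section_mul_of_pullback_fst_comp_eq_of_isLocallyNoetherian`) applied to the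
`Spec R`-endomorphisms of `A ×_k Spec R` defined by `Φ` and by the translation; they agree on the closed fibre and at the
origin. [cite: MumfordFogartyKirwan1994, Ch. 6 §1 Cor. 6.2 (p. 116)] [cite: MumfordAV1970, §13, proof of the Theorem (p. 125)] -/
theorem whiskerLeft_comp_mul_eq_of_closedFibreι_comp_eq_id (Φ : A.X ⊗ R.specOver ⟶ A.X)
    (h0 : closedFibreι A.X R ≫ Φ.left = 𝟙 A.left) :
    (A.X ◁ (lift (toUnit _ ≫ η[A.X]) (𝟙 _) ≫ Φ)) ≫ μ[A.X] = Φ := by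
  -- names
  let T : Motives.SchemeOver k := R.specOver
  let u : T ⟶ A.X := lift (toUnit T ≫ η[A.X]) (𝟙 T) ≫ Φ
  let τ : A.X ⊗ T ⟶ A.X := (A.X ◁ u) ≫ μ[A.X]
  change τ = Φ
  -- the closed point `s₀ : Spec k ⟶ Spec R` over `Spec k`
  have hs : Spec.map (CommRingCat.ofHom R.residue.toRingHom) ≫ T.hom = 𝟙 _ := by
    change Spec.map _ ≫ Spec.map _ = 𝟙 _
    rw [← Spec.map_comp, ← CommRingCat.ofHom_comp, ArtAlg.residue_toRingHom_comp_algebraMap, CommRingCat.ofHom_id,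
      Spec.map_id]
  let s₀ : 𝟙_ (Motives.SchemeOver k) ⟶ T := Over.homMk (Spec.map (CommRingCat.ofHom R.residue.toRingHom)) hs
  have hs₀ : s₀.left ≫ T.hom = 𝟙 _ := hs
  have hι : closedFibreι A.X R = ((ρ_ A.X).inv ≫ A.X ◁ s₀).left := closedFibreι_eq_left A.X R s₀ rfl
  -- (1) the value of `u` at the closed point is the origin
  have hΦ0 : ((ρ_ A.X).inv ≫ A.X ◁ s₀) ≫ Φ = 𝟙 A.X := by
    apply Over.OverMorphism.ext
    rw [Over.comp_left, ← hι, h0]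
    rfl
  have hu0 : s₀ ≫ u = η[A.X] := by
    change s₀ ≫ lift (toUnit T ≫ η[A.X]) (𝟙 T) ≫ Φ = η[A.X]
    rw [comp_lift_assoc, Category.comp_id, ← Category.assoc, show s₀ ≫ toUnit T = 𝟙 _ from toUnit_unique _ _,
      Category.id_comp, ← comp_rightUnitor_inv_whiskerLeft, Category.assoc, hΦ0, Category.comp_id]
  -- (2) the translation is the identity on the closed fibre
  have hτ0 : closedFibreι A.X R ≫ τ.left = 𝟙 A.left := by
    have h : ((ρ_ A.X).inv ≫ A.X ◁ s₀) ≫ τ = 𝟙 A.X := by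
      change ((ρ_ A.X).inv ≫ A.X ◁ s₀) ≫ (A.X ◁ u) ≫ μ[A.X] = 𝟙 A.X
      rw [Category.assoc, ← whiskerLeft_comp_assoc, hu0, MonObj.mul_one, Iso.inv_hom_id]
    rw [hι, ← Over.comp_left, h]
    rfl
  -- (3) over the Artin base `Spec R`
  let A' : AbelianSchemeOver T.left := A.baseChange T.hom
  haveI : IsLocallyNoetherian T.left := inferInstanceAs (IsLocallyNoetherian (Spec (CommRingCat.of R)))
  haveI : Subsingleton ↥T.left := subsingleton_specOver_left R
  haveI : PreconnectedSpace ↥T.left := ⟨Set.subsingleton_univ.isPreconnected⟩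
  haveI : IsSeparated A'.X.hom := by
    haveI := A'.isProper
    infer_instance
  have wΦ : Φ.left ≫ A.X.hom = pullback.snd A.X.hom T.hom ≫ T.hom := (Over.w Φ).trans pullback.condition
  have wτ : τ.left ≫ A.X.hom = pullback.snd A.X.hom T.hom ≫ T.hom := (Over.w τ).trans pullback.condition
  let Φ' : A'.X ⟶ A'.X := Over.homMk (pullback.lift Φ.left (pullback.snd A.X.hom T.hom) wΦ) (pullback.lift_snd _ _ _)
  let τ' : A'.X ⟶ A'.X := Over.homMk (pullback.lift τ.left (pullback.snd A.X.hom T.hom) wτ) (pullback.lift_snd _ _ _)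
  have hΦ' : Φ'.left = pullback.lift Φ.left (pullback.snd A.X.hom T.hom) wΦ := rfl
  have hτ' : τ'.left = pullback.lift τ.left (pullback.snd A.X.hom T.hom) wτ := rfl
  -- (4) `Φ'` and `τ'` agree on the closed fibre
  have hfib : pullback.fst A'.X.hom s₀.left ≫ Φ'.left = pullback.fst A'.X.hom s₀.left ≫ τ'.left := by
    have hq : pullback.fst A'.X.hom s₀.left =
        (pullback.fst A'.X.hom s₀.left ≫ pullback.fst A.X.hom T.hom) ≫ closedFibreι A.X R := by
      apply pullback.hom_ext
      · rw [Category.assoc, closedFibreι_fst, Category.comp_id]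
      · have e1 : pullback.fst A'.X.hom s₀.left ≫ pullback.snd A.X.hom T.hom = pullback.snd A'.X.hom s₀.left ≫ s₀.left :=
          pullback.condition
        rw [Category.assoc, closedFibreι_snd, Category.assoc, ← Category.assoc (pullback.fst A.X.hom T.hom),
          pullback.condition, Category.assoc, ← Category.assoc (pullback.fst A'.X.hom s₀.left), e1, Category.assoc,
          ← Category.assoc s₀.left, hs₀, Category.id_comp]
        rfl
    have hιΦτ : closedFibreι A.X R ≫ Φ'.left = closedFibreι A.X R ≫ τ'.left := by
      rw [hΦ', hτ']
      apply pullback.hom_ext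
      · rw [Category.assoc, Category.assoc, pullback.lift_fst, pullback.lift_fst, h0, hτ0]
      · rw [Category.assoc, Category.assoc, pullback.lift_snd, pullback.lift_snd]
    rw [hq]
    simp only [Category.assoc, hιΦτ]
  have key := A'.eq_section_mul_of_pullback_fst_comp_eq_of_isLocallyNoetherian Φ' τ' s₀.left hfib
  -- (5) `Φ'` and `τ'` agree at the origin
  have hη' : η[A'.X].left = (lift (toUnit T ≫ η[A.X]) (𝟙 T)).left := by
    apply pullback.hom_ext
    · rw [A.one_baseChange_left_comp_fst]
      change _ = (lift (toUnit T ≫ η[A.X]) (𝟙 T)).left ≫ (fst A.X T).left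
      rw [← Over.comp_left, lift_fst, Over.comp_left, Over.toUnit_left]
    · change η[A'.X].left ≫ A'.X.hom = (lift (toUnit T ≫ η[A.X]) (𝟙 T)).left ≫ (snd A.X T).left
      rw [Over.w, ← Over.comp_left, lift_snd]
      rfl
  have hη : η[A'.X] ≫ Φ' = η[A'.X] ≫ τ' := by
    apply Over.OverMorphism.ext
    rw [Over.comp_left, Over.comp_left, hη', hΦ', hτ']
    apply pullback.hom_ext
    · rw [Category.assoc, Category.assoc, pullback.lift_fst, pullback.lift_fst, ← Over.comp_left, ← Over.comp_left]
      change u.left = (lift (toUnit T ≫ η[A.X]) (𝟙 T) ≫ (A.X ◁ u) ≫ μ[A.X]).left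
      rw [lift_whiskerLeft_assoc, Category.id_comp, ← Hom.mul_def, ← Hom.one_def, one_mul]
    · rw [Category.assoc, Category.assoc, pullback.lift_snd, pullback.lift_snd]
  have hsec : toUnit A'.X ≫ η[A'.X] ≫ (Φ' * τ'⁻¹) = 1 := by
    rw [MonObj.comp_mul, GrpObj.comp_inv, hη, mul_inv_cancel, MonObj.comp_one]
  rw [hsec, one_mul] at key
  -- (6) back to `Over (Spec k)`
  have e : Φ.left = τ.left := by
    have e1 : Φ'.left ≫ pullback.fst A.X.hom T.hom = Φ.left := by rw [hΦ', pullback.lift_fst]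
    have e2 : τ'.left ≫ pullback.fst A.X.hom T.hom = τ.left := by rw [hτ', pullback.lift_fst]
    rw [← e1, key, e2]
  exact (Over.OverMorphism.ext e).symm

end AbelianSchemeOver

end Literature.AlgebraicGeometry.AbelianSchemes

end
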